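import Literature.Topology.FourManifolds.CircleSurgeryFundamentalGroup
import Literature.Topology.FourManifolds.CircleSurgerySimplyConnected
import Literature.Topology.FourManifolds.LinkingNumberSymmProofs
import Literature.Topology.FourManifolds.CircleMapsConjugateLoops
import Literature.Topology.FourManifolds.SphereTwoProdCircleSumFundamentalGroup
import Literature.Topology.FourManifolds.SphereSurgeryPi1
import Literature.Topology.FourManifolds.SPC4HandlesProofs
import Literature.AlgebraicTopology.FundamentalGroup.CircleAndTorus
import Literature.AlgebraicTopology.FundamentalGroup.CircleValuedWinding
import Literature.AlgebraicTopology.FundamentalGroup.SphereCoreComplementPi1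
import Literature.AlgebraicTopology.FundamentalGroup.VanKampenKernel
import Literature.AlgebraicTopology.FundamentalGroup.BasePointTransfer
import Literature.AlgebraicTopology.FundamentalGroup.SpunFundamentalGroup
import HarnessLib

/-!
# Proof: the fundamental group of a circle surgery — a simply connected circle surgery kills
# exactly the normal closure of the circle (Juhász 2023, Lemma 2.56)

Sibling proof file of `Literature/Topology/FourManifolds/CircleSurgeryFundamentalGroup.lean`
(D-0014: the named fact `def X : Prop` is discharged as `theorem X_holds : X`).  It PROVES
`Literature.Topology.FourManifolds.circleSurgery_normalClosure_loop_eq_top_holds :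
circleSurgery_normalClosure_loop_eq_top` — A. Juhász, *Differential and Low-Dimensional Topology*
(2023), Lemma 2.56: "If `n > 3`, then `π₁(M(S, ν)) ≅ π₁(M)/⟨⟨[S]⟩⟩`" (A. Kosinski, *Differential
Manifolds* (1993), VII Lemma (1.2)), in the consequence form vendored by the named fact: if the
surgered `4`-manifold `M = X_c` (`Literature.Topology.FourManifolds.IsCircleSurgery`, either
framing) is simply connected, then the class of `t ↦ c (cos 2πt, sin 2πt)` normally generates
`π₁(X, c(1, 0))` (`X` closed, connected, smooth).

## Proof

Let `ν : 𝕊¹ × ℝ³ ↪ X` be the tube and `j_A : X ∖ c → M`, `j_B : D̊² × 𝕊² → M` the gluing maps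
of the surgery presentation; `x₁ = ν((1,0), w₀)` with `w₀ = e₀/2`, and `gp ∈ π₁(X, x₁)` the class
of the longitude ("push-off") `t ↦ ν((cos 2πt, sin 2πt), w₀)`.
* **Step A — `⟨⟨gp⟩⟩ = π₁(X, x₁)`.**  `M = j_A(X ∖ c) ∪ j_B(D̊² × 𝕊²)` is an open cover with
  path-connected pieces and overlap (the tree's `isPathConnected_range_inter_range_of_circleSurgeryRel`;
  `X ∖ c` is path connected by rerouting through the punctured tube,
  `isPathConnected_compl_of_nbhd`).  Let `Φ : π₁(j_A(X ∖ c), j_A x₁) ≅ π₁(X ∖ c, x₁) → π₁(X, x₁)`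
  and `N = Φ⁻¹ ⟨⟨gp⟩⟩`, a normal subgroup.  A loop of `j_A(X ∖ c)` at `j_A x₁` lying in
  `j_B(D̊² × 𝕊²)` is, read in `X` through the gluing relation `circleSurgeryRel`, a loop inside the
  tube `ν(𝕊¹ × ℝ³)`, hence its class is a power of `gp` (`fromPath_mem_zpowers_of_subset_range`:
  lift along the embedding `ν` to `𝕊¹ × ℝ³`, whose fundamental group at `((1,0), w₀)` is
  generated by the longitude, `zpowers_prod_loop_eq_top`, from `π₁(𝕊¹) = ⟨[ω]⟩`, Hatcher Thm. 1.7,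
  the tree's `zpowers_addCircleLoop`, and `π₁(A × B) ≅ π₁(A) × π₁(B)`, Prop. 1.12, the tree's
  `fundamentalGroupProdEquiv`), so it lies in `N`.  By **van Kampen in kernel form** (Hatcher
  Thm. 1.20; the tree's `VanKampen.fromPath_mem_of_homotopic_refl`) every loop of `j_A(X ∖ c)`
  that is null-homotopic in `M` — i.e. every loop, `M` being simply connected — has class in `N`.
  Since `π₁(X ∖ c, x₁) → π₁(X, x₁)` is onto (codimension `3`; the tree's
  `VanKampen.bijective_inclHom_compl_core`), `⟨⟨gp⟩⟩ = π₁(X, x₁)`.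
* **Step C — change of base point.**  `(s, u) ↦ ν(u, s·w₀)` is a free homotopy from `c` to the
  push-off, so the two circle loops are conjugate in the fundamental groupoid
  (`ContinuousMap.homotopic_iff_loopConj`): `gp = T[c.circleLoop]` for the transport
  `T = pathConj τ⁻¹ : π₁(X, c(1,0)) ≅ π₁(X, x₁)` along a path `τ`; isomorphisms preserve normal
  closures.

Everything is proved; no definition and no named fact is introduced.

## References

* [Juhasz2023] A. Juhász, *Differential and Low-Dimensional Topology*, CUP (2023), Lemma 2.56.
* [Kosinski1993] A. Kosinski, *Differential Manifolds* (1993), Ch. VII §1, Lemma (1.2); Ch. X §2.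
* [HatcherAT2002] A. Hatcher, *Algebraic Topology* (2002), Thm. 1.7, Prop. 1.12, Thm. 1.20,
  Prop. 1.5.
-/

noncomputable section

open Set Function Metric
open scoped Manifold ContDiff Topology unitInterval
open Literature.AlgebraicTopology.FundamentalGroup Literature.AlgebraicTopology.FundamentalGroup.VanKampen

namespace Literature.Topology.FourManifolds

universe u

/-! ### The standard loop generates `π₁(𝕊¹)`; the longitude generates `π₁(𝕊¹ × E)` -/

/-- **`π₁(𝕊¹, (1, 0))` is generated by the class of the standard loop `t ↦ (cos 2πt, sin 2πt)`**
(Hatcher 2002, Thm. 1.7; the tree's `zpowers_addCircleLoop` for `ℝ/2πℤ`, transported along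
`ℝ/2πℤ ≃ₜ Circle ≃ₜ 𝕊¹`). [cite: HatcherAT2002, Thm. 1.7 (p. 29)] -/
theorem zpowers_circleLoop_id_eq_top :
    Subgroup.zpowers (FundamentalGroup.fromPath
      (Path.Homotopic.Quotient.mk (ContinuousMap.id (Metric.sphere (0 : EuclideanSpace ℝ (Fin 2)) 1)).circleLoop) :
        FundamentalGroup (Metric.sphere (0 : EuclideanSpace ℝ (Fin 2)) 1) (circlePoint 0)) = ⊤ := by
  let h : AddCircle (2 * Real.pi) ≃ₜ (Metric.sphere (0 : EuclideanSpace ℝ (Fin 2)) 1) :=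
    AddCircle.homeomorphCircle'.trans circleHomeomorphSphereOne
  have hcoe : ∀ s : ℝ, h ((s : ℝ) : AddCircle (2 * Real.pi)) = circlePoint s := fun s => by
    show circleHomeomorphSphereOne (AddCircle.homeomorphCircle' (s : AddCircle (2 * Real.pi))) = _
    rw [AddCircle.homeomorphCircle'_apply_mk, circleHomeomorphSphereOne_exp]
  have h0 : h ((0 : ℝ) : AddCircle (2 * Real.pi)) = circlePoint 0 := hcoe 0
  let ε := Homeomorph.fundamentalGroupCongr h h0
  have hgen := zpowers_addCircleLoop (p := 2 * Real.pi) (by positivity) ((0 : ℝ) : AddCircle (2 * Real.pi))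
  have himg := congrArg (Subgroup.map ε.toMonoidHom) hgen
  have hs : Function.Surjective (ε.toMonoidHom : _ →* _) := ε.surjective
  rw [MonoidHom.map_zpowers, Subgroup.map_top_of_surjective _ hs] at himg
  have hpath : ((addCircleLoop (2 * Real.pi) ((0 : ℝ) : AddCircle (2 * Real.pi))).map
      h.continuous).cast h0.symm h0.symm = (ContinuousMap.id (Metric.sphere (0 : EuclideanSpace ℝ (Fin 2)) 1)).circleLoop := by
    refine Path.ext (funext fun t => ?_)
    show h (addCircleLoop (2 * Real.pi) ((0 : ℝ) : AddCircle (2 * Real.pi)) t) = circleParam t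
    rw [addCircleLoop_apply, ← AddCircle.coe_add, hcoe, circleParam_apply]
    congr 1
    ring
  rw [← himg, MulEquiv.coe_toMonoidHom, Homeomorph.fundamentalGroupCongr_apply, mapOfEq_fromPath,
    hpath]

/-- **`π₁(𝕊¹ × E, ((1, 0), w₀))` is generated by the class of the loop
`t ↦ ((cos 2πt, sin 2πt), w₀)`** for a real normed space `E` (Hatcher 2002, Prop. 1.12:
`π₁(A × B) ≅ π₁(A) × π₁(B)`, the tree's `fundamentalGroupProdEquiv`; `E` is simply connected).
[cite: HatcherAT2002, Prop. 1.12 (p. 34)] -/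
theorem zpowers_prod_loop_eq_top {E : Type*} [NormedAddCommGroup E] [NormedSpace ℝ E] (w₀ : E) :
    Subgroup.zpowers (FundamentalGroup.fromPath
      (Path.Homotopic.Quotient.mk (((ContinuousMap.id (Metric.sphere (0 : EuclideanSpace ℝ (Fin 2)) 1)).circleLoop).prod (Path.refl w₀))) :
        FundamentalGroup ((Metric.sphere (0 : EuclideanSpace ℝ (Fin 2)) 1) × E) (circlePoint 0, w₀)) = ⊤ := by
  haveI : SimplyConnectedSpace E := simplyConnectedSpace_of_normedSpace
  set lp := (ContinuousMap.id (Metric.sphere (0 : EuclideanSpace ℝ (Fin 2)) 1)).circleLoop with hlp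
  set glp : FundamentalGroup (Metric.sphere (0 : EuclideanSpace ℝ (Fin 2)) 1) (circlePoint 0) :=
    FundamentalGroup.fromPath (Path.Homotopic.Quotient.mk lp) with hglp
  let e := fundamentalGroupProdEquiv (circlePoint 0) w₀
  have he : e (FundamentalGroup.fromPath (Path.Homotopic.Quotient.mk (lp.prod (Path.refl w₀)))) =
      (glp, 1) := by
    apply e.symm.injective
    rw [MulEquiv.symm_apply_apply]
    show _ = (fundamentalGroupProdEquiv (circlePoint 0) w₀).symm
      (FundamentalGroup.fromPath (Path.Homotopic.Quotient.mk lp),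
        FundamentalGroup.fromPath (Path.Homotopic.Quotient.mk (Path.refl w₀)))
    rw [fundamentalGroupProdEquiv_symm_apply_mk]
    rfl
  rw [Subgroup.eq_top_iff']
  intro g
  have h1 : (e g).1 ∈ Subgroup.zpowers glp := by
    rw [hglp, hlp, zpowers_circleLoop_id_eq_top]; exact Subgroup.mem_top _
  obtain ⟨n, hn⟩ := Subgroup.mem_zpowers_iff.1 h1
  refine Subgroup.mem_zpowers_iff.2 ⟨n, e.injective ?_⟩
  rw [map_zpow, he, Prod.ext_iff]
  refine ⟨?_, Subsingleton.elim _ _⟩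
  rw [Prod.pow_fst]
  exact hn

/-! ### Loops inside a tube `φ(𝕊¹ × E)` are powers of its longitude -/

/-- **A loop of `X` lying in the image of an embedding `φ : 𝕊¹ × E → X`, based at
`φ((1, 0), w₀)`, has class a power of the class of the longitude `t ↦ φ((cos 2πt, sin 2πt), w₀)`**
(lift the loop to `𝕊¹ × E` along the embedding, where the longitude generates,
`zpowers_prod_loop_eq_top`, and push forward). [folklore] -/
theorem fromPath_mem_zpowers_of_subset_range {X : Type*} [TopologicalSpace X] {E : Type*}
    [NormedAddCommGroup E] [NormedSpace ℝ E] {φ : (Metric.sphere (0 : EuclideanSpace ℝ (Fin 2)) 1) × E → X} (hφ : Topology.IsEmbedding φ)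
    (w₀ : E) (δ : Path (φ (circlePoint 0, w₀)) (φ (circlePoint 0, w₀)))
    (hδ : ∀ t, δ t ∈ range φ) :
    FundamentalGroup.fromPath (Path.Homotopic.Quotient.mk δ) ∈
      Subgroup.zpowers (FundamentalGroup.fromPath (Path.Homotopic.Quotient.mk
        ((((ContinuousMap.id (Metric.sphere (0 : EuclideanSpace ℝ (Fin 2)) 1)).circleLoop).prod (Path.refl w₀)).map hφ.continuous)) :
          FundamentalGroup X (φ (circlePoint 0, w₀))) := by
  let hom := hφ.toHomeomorph
  let δ' := liftPath (range φ) δ hδ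
  have hq : hom.symm (hom (circlePoint 0, w₀)) = (circlePoint 0, w₀) := hom.symm_apply_apply _
  let ε : Path (hom.symm (hom (circlePoint 0, w₀))) (hom.symm (hom (circlePoint 0, w₀))) :=
    δ'.map hom.symm.continuous
  let ε' : Path ((circlePoint 0, w₀) : (Metric.sphere (0 : EuclideanSpace ℝ (Fin 2)) 1) × E) (circlePoint 0, w₀) := ε.cast hq.symm hq.symm
  have hmem : FundamentalGroup.fromPath (Path.Homotopic.Quotient.mk ε') ∈
      Subgroup.zpowers (FundamentalGroup.fromPath
        (Path.Homotopic.Quotient.mk (((ContinuousMap.id (Metric.sphere (0 : EuclideanSpace ℝ (Fin 2)) 1)).circleLoop).prod (Path.refl w₀))) :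
          FundamentalGroup ((Metric.sphere (0 : EuclideanSpace ℝ (Fin 2)) 1) × E) (circlePoint 0, w₀)) := by
    rw [zpowers_prod_loop_eq_top]; exact Subgroup.mem_top _
  obtain ⟨n, hn⟩ := Subgroup.mem_zpowers_iff.1 hmem
  let φC : C((Metric.sphere (0 : EuclideanSpace ℝ (Fin 2)) 1) × E, X) := ⟨φ, hφ.continuous⟩
  have hval : ∀ y : range φ, φ (hom.symm y) = (y : X) := fun y =>
    congrArg Subtype.val (hom.apply_symm_apply y)
  have hmapδ : FundamentalGroup.map φC (circlePoint 0, w₀)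
      (FundamentalGroup.fromPath (Path.Homotopic.Quotient.mk ε')) =
      FundamentalGroup.fromPath (Path.Homotopic.Quotient.mk δ) := by
    rw [map_fromPath_mk]
    congr 2
    refine Path.ext (funext fun t => ?_)
    exact hval (δ' t)
  have hmapω : FundamentalGroup.map φC (circlePoint 0, w₀) (FundamentalGroup.fromPath
      (Path.Homotopic.Quotient.mk (((ContinuousMap.id (Metric.sphere (0 : EuclideanSpace ℝ (Fin 2)) 1)).circleLoop).prod (Path.refl w₀))) :
          FundamentalGroup ((Metric.sphere (0 : EuclideanSpace ℝ (Fin 2)) 1) × E) (circlePoint 0, w₀)) =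
      FundamentalGroup.fromPath (Path.Homotopic.Quotient.mk
        ((((ContinuousMap.id (Metric.sphere (0 : EuclideanSpace ℝ (Fin 2)) 1)).circleLoop).prod (Path.refl w₀)).map hφ.continuous)) :=
    map_fromPath_mk _ _
  rw [← hmapδ, ← hn, map_zpow, hmapω]
  exact Subgroup.zpow_mem _ (Subgroup.mem_zpowers _) n

/-! ### The theorem -/

open _root_.Topology (IsOpenEmbedding IsEmbedding)
open Literature.AlgebraicTopology.FundamentalGroup.BasePointTransfer

/-- **Juhász 2023, Lemma 2.56 (Kosinski 1993, VII Lemma (1.2)), consequence form, PROVED —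
discharge of the named fact
`Literature.Topology.FourManifolds.circleSurgery_normalClosure_loop_eq_top`**
(`CircleSurgeryFundamentalGroup.lean`): if the smooth `4`-manifold `M` obtained from the closed
connected smooth `4`-manifold `X` by surgery on the smoothly embedded circle `c`
(`IsCircleSurgery`, either framing) is simply connected, then the class of the loop
`t ↦ c (cos 2πt, sin 2πt)` normally generates `π₁(X, c(1, 0))`.  Proof (module docstring): van
Kampen's theorem in kernel form for the cover of `M` by the images of `X ∖ c` and `D̊² × 𝕊²`,
the surjection `π₁(X ∖ c) → π₁(X)`, the longitude lemma for loops in the tube, and the change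
of base point along the free homotopy `(s, u) ↦ ν(u, s·w₀)` from `c` to its push-off.
[cite: Juhasz2023, Lemma 2.56] [cite: Kosinski1993, Ch. VII §1, Lemma (1.2)] [cite: HatcherAT2002, Thm. 1.20] -/
theorem circleSurgery_normalClosure_loop_eq_top_holds :
    circleSurgery_normalClosure_loop_eq_top.{u} := by
  intro X _ _ _ _ _ _ _ c hc M _ _ _ _ _ hs
  haveI := Fact.mk (@finrank_euclideanSpace_fin ℝ _ 2)
  haveI := Fact.mk (@finrank_euclideanSpace_fin ℝ _ 3)
  haveI := Fact.mk (@finrank_euclideanSpace_fin ℝ _ 4)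
  obtain ⟨ν, jA, jB, hA, hAo, hB, hBo, hU, hR⟩ := hs
  have hν : IsOpenEmbedding ν.toFun := ⟨ν.isSmoothEmbedding.isEmbedding, ν.isOpen_range⟩
  have hA' : IsOpenEmbedding jA := ⟨hA.isEmbedding, hAo⟩
  have hB' : IsOpenEmbedding jB := ⟨hB.isEmbedding, hBo⟩
  -- instances: `X` path connected, the model fibre data of the tube
  haveI : LocallyPathConnectedSpace X :=
    ChartedSpace.locallyPathConnectedSpace (EuclideanSpace ℝ (Fin 4)) X
  haveI : PathConnectedSpace X := pathConnectedSpace_iff_connectedSpace.2 inferInstance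
  have hrank2 : 1 < Module.rank ℝ (EuclideanSpace ℝ (Fin 2)) := by
    rw [← Module.finrank_eq_rank, finrank_euclideanSpace_fin]; exact Nat.one_lt_cast.mpr (by norm_num)
  have hrank3 : 1 < Module.rank ℝ (EuclideanSpace ℝ (Fin 3)) := by
    rw [← Module.finrank_eq_rank, finrank_euclideanSpace_fin]; exact Nat.one_lt_cast.mpr (by norm_num)
  haveI : PathConnectedSpace (Metric.sphere (0 : EuclideanSpace ℝ (Fin 2)) 1) := isPathConnected_iff_pathConnectedSpace.mp
    (isPathConnected_sphere hrank2 (0 : EuclideanSpace ℝ (Fin 2)) zero_le_one)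
  haveI : SimplyConnectedSpace (EuclideanSpace ℝ (Fin 3)) := simplyConnectedSpace_of_normedSpace
  haveI : SimplyConnectedSpace ↥(({0} : Set (EuclideanSpace ℝ (Fin 3)))ᶜ) :=
    FramedSphereFamily.simplyConnectedSpace_compl_zero (l := 2) le_rfl
  -- the base point off the circle: `x₁ = ν ((1, 0), w₀)`, `w₀ = e₀ / 2`
  set e₀ : EuclideanSpace ℝ (Fin 3) := EuclideanSpace.single 0 1 with he₀def
  have he₀ : ‖e₀‖ = 1 := by simp [he₀def]
  have he₀ne : e₀ ≠ 0 := fun h => by rw [h, norm_zero] at he₀; exact zero_ne_one he₀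
  set w₀ : EuclideanSpace ℝ (Fin 3) := (2⁻¹ : ℝ) • e₀ with hw₀def
  have hw₀ : w₀ ≠ 0 := smul_ne_zero (by norm_num) he₀ne
  -- the core `S = ν(S¹ × 0) = c(S¹)` and its complement
  set S : Set X := ν.toFun '' (univ ×ˢ ({0} : Set (EuclideanSpace ℝ (Fin 3)))) with hSdef
  have hS : S = range c := ν.image_zeroSection
  have hSc : Sᶜ = ((ν.complement : TopologicalSpace.Opens X) : Set X) := by rw [hS]; rfl
  have hx₁S : ν.toFun (circlePoint 0, w₀) ∈ Sᶜ := by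
    rintro ⟨⟨u, w⟩, ⟨-, hw⟩, huw⟩
    rw [mem_singleton_iff] at hw
    subst hw
    exact hw₀ (congrArg Prod.snd (hν.injective huw)).symm
  let eS : ↥Sᶜ ≃ₜ ↥ν.complement := Homeomorph.setCongr hSc
  let a₁ : ↥ν.complement := eS ⟨ν.toFun (circlePoint 0, w₀), hx₁S⟩
  -- `jA a₁` lies in the new piece too
  let v₀ : (Metric.sphere (0 : EuclideanSpace ℝ (Fin 3)) 1) := ⟨e₀, by simp [he₀]⟩
  let b₁ : ↥discTimesSphere :=
    ⟨((2⁻¹ : ℝ) • ((circlePoint 0 : (Metric.sphere (0 : EuclideanSpace ℝ (Fin 2)) 1)) : EuclideanSpace ℝ (Fin 2)), v₀), by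
      rw [mem_discTimesSphere_iff, norm_smul, norm_eq_of_mem_sphere]; norm_num⟩
  have hrel₁ : circleSurgeryRel ν a₁ b₁ :=
    ⟨circlePoint 0, 2⁻¹, ⟨by norm_num, by norm_num⟩, rfl, rfl⟩
  have hy₁T : jA a₁ ∈ range jB := ⟨b₁, ((hR a₁ b₁).2 hrel₁).symm⟩
  have hy₁U : jA a₁ ∈ range jA := mem_range_self a₁
  -- the push-off of `c` through `x₁` and its class `gp`
  let push : Path (ν.toFun (circlePoint 0, w₀)) (ν.toFun (circlePoint 0, w₀)) :=
    (((ContinuousMap.id (Metric.sphere (0 : EuclideanSpace ℝ (Fin 2)) 1)).circleLoop).prod (Path.refl w₀)).map hν.continuous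
  let gp : FundamentalGroup X (ν.toFun (circlePoint 0, w₀)) :=
    FundamentalGroup.fromPath (Path.Homotopic.Quotient.mk push)
  -- ### Step A: the normal closure of `gp` is all of `π₁(X, x₁)`
  have hgen : Subgroup.normalClosure {gp} = ⊤ := by
    -- the pieces of the van Kampen cover of `M`
    have hUpc : IsPathConnected (range jA) := by
      -- `X ∖ c` is path connected: reroute through the punctured tube
      have hScpc : IsPathConnected Sᶜ := by
        have hTS : IsPathConnected (range ν.toFun \ S) := by
          have hP : IsPathConnected
              ((univ : Set (Metric.sphere (0 : EuclideanSpace ℝ (Fin 2)) 1)) ×ˢ (({0} : Set (EuclideanSpace ℝ (Fin 3)))ᶜ)) :=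
            isPathConnected_univ.prod (isPathConnected_compl_singleton_of_one_lt_rank hrank3 0)
          have himg := hP.image hν.continuous
          have hset : ν.toFun '' ((univ : Set (Metric.sphere (0 : EuclideanSpace ℝ (Fin 2)) 1)) ×ˢ (({0} : Set (EuclideanSpace ℝ (Fin 3)))ᶜ)) =
              range ν.toFun \ S := by
            have := image_compl_zero_eq (Z := (Metric.sphere (0 : EuclideanSpace ℝ (Fin 2)) 1)) (E := EuclideanSpace ℝ (Fin 3)) hν.injective
            rw [sdiff_eq, inter_comm, hSdef, ← this]
            congr 1
            ext q; simp
          rwa [hset] at himg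
        exact isPathConnected_compl_of_nbhd (S := S) (T := range ν.toFun)
          (isClosed_image_core hν.continuous) ν.isOpen_range (image_subset_range _ _)
          isPathConnected_univ hTS
      haveI : PathConnectedSpace ↥ν.complement := by
        refine isPathConnected_iff_pathConnectedSpace.mp ?_
        show IsPathConnected ((ν.complement : TopologicalSpace.Opens X) : Set X)
        rw [← hSc]; exact hScpc
      exact isPathConnected_range hA'.continuous
    have hmeet : IsPathConnected (range jA ∩ range jB) :=
      isPathConnected_range_inter_range_of_circleSurgeryRel hB' hR
    -- the homomorphism `Φ : π₁(jA(X ∖ c), jA a₁) ≅ π₁(X ∖ c, x₁) → π₁(X, x₁)`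
    let eA : ↥Sᶜ ≃ₜ ↥(range jA) := eS.trans hA'.isEmbedding.toHomeomorph
    have heA : eA.symm ⟨jA a₁, hy₁U⟩ = ⟨ν.toFun (circlePoint 0, w₀), hx₁S⟩ := eA.symm_apply_apply _
    let ε₁ := Homeomorph.fundamentalGroupCongr eA.symm heA
    let ι := inclHom Sᶜ (ν.toFun (circlePoint 0, w₀)) hx₁S
    let Φ : FundamentalGroup ↥(range jA) ⟨jA a₁, hy₁U⟩ →* FundamentalGroup X (ν.toFun (circlePoint 0, w₀)) :=
      ι.comp ε₁.toMonoidHom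
    let N : Subgroup (FundamentalGroup ↥(range jA) ⟨jA a₁, hy₁U⟩) :=
      (Subgroup.normalClosure {gp}).comap Φ
    haveI : N.Normal := Subgroup.normal_comap _
    -- loops of `jA(X ∖ c)` inside `jB(D̊² × S²)` are loops of the tube: powers of `gp`
    have hN : ∀ δ : Path (⟨jA a₁, hy₁U⟩ : ↥(range jA)) ⟨jA a₁, hy₁U⟩,
        (∀ t, (δ t : M) ∈ range jB) →
          FundamentalGroup.fromPath (Path.Homotopic.Quotient.mk δ) ∈ N := by
      intro δ hδ
      show Φ (FundamentalGroup.fromPath (Path.Homotopic.Quotient.mk δ)) ∈ Subgroup.normalClosure {gp}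
      -- the loop read in `X`
      let δX : Path (ν.toFun (circlePoint 0, w₀)) (ν.toFun (circlePoint 0, w₀)) :=
        ((δ.map eA.symm.continuous).cast heA.symm heA.symm).map continuous_subtype_val
      have hΦδ : Φ (FundamentalGroup.fromPath (Path.Homotopic.Quotient.mk δ)) =
          FundamentalGroup.fromPath (Path.Homotopic.Quotient.mk δX) := by
        show ι (ε₁ (FundamentalGroup.fromPath (Path.Homotopic.Quotient.mk δ))) = _
        rw [Homeomorph.fundamentalGroupCongr_apply, mapOfEq_fromPath, inclHom_fromPath]
      have hδX : ∀ t, δX t ∈ range ν.toFun := by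
        intro t
        obtain ⟨b, hb⟩ := hδ t
        have hjA : jA (eS (eA.symm (δ t))) = (δ t : M) :=
          congrArg Subtype.val (eA.apply_symm_apply (δ t))
        obtain ⟨u, s, -, -, ha⟩ := (hR (eS (eA.symm (δ t))) b).1 (hjA.trans hb.symm)
        exact ⟨_, ha.symm⟩
      rw [hΦδ]
      exact Subgroup.zpowers_le.mpr (Subgroup.subset_normalClosure (mem_singleton gp))
        (fromPath_mem_zpowers_of_subset_range hν.isEmbedding w₀ δX hδX)
    -- van Kampen, kernel form, with `M` simply connected: every loop of `jA(X ∖ c)` lies in `N`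
    have hall : ∀ γ : Path (⟨jA a₁, hy₁U⟩ : ↥(range jA)) ⟨jA a₁, hy₁U⟩,
        FundamentalGroup.fromPath (Path.Homotopic.Quotient.mk γ) ∈ N := fun γ =>
      fromPath_mem_of_homotopic_refl hAo hBo hU hUpc hmeet hy₁U hy₁T N hN γ
        (SimplyConnectedSpace.paths_homotopic _ _)
    -- `ι` is onto (`π₁(X ∖ c) → π₁(X)` is, in codimension `3`), so the normal closure is everything
    have hιs : Function.Surjective ι :=
      (bijective_inclHom_compl_core (Z := (Metric.sphere (0 : EuclideanSpace ℝ (Fin 2)) 1)) (E := EuclideanSpace ℝ (Fin 3)) (W := X)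
        hν (q₀ := (circlePoint 0, w₀)) hw₀).2
    rw [eq_top_iff]
    rintro g -
    obtain ⟨g', rfl⟩ := hιs g
    have hmem : ε₁.symm g' ∈ N := ind_fromPath (motive := fun a => a ∈ N) hall _
    have hΦ : Φ (ε₁.symm g') = ι g' := by
      show ι (ε₁ (ε₁.symm g')) = ι g'
      rw [MulEquiv.apply_symm_apply]
    rw [← hΦ]
    exact hmem
  -- ### Step C: move the base point to `c (1, 0)` along the free homotopy `(s, u) ↦ ν (u, s • w₀)`
  let cpush : C((Metric.sphere (0 : EuclideanSpace ℝ (Fin 2)) 1), X) := ⟨fun u => ν.toFun (u, w₀), hν.continuous.comp (by fun_prop)⟩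
  have hfree : c.Homotopic cpush :=
    ⟨{ toFun := fun p => ν.toFun (p.2, (p.1 : ℝ) • w₀)
       continuous_toFun := hν.continuous.comp (by fun_prop)
       map_zero_left := fun u => by
         show ν.toFun (u, ((0 : I) : ℝ) • w₀) = c u
         rw [Set.Icc.coe_zero, zero_smul, ν.apply_zero]
       map_one_left := fun u => by
         show ν.toFun (u, ((1 : I) : ℝ) • w₀) = ν.toFun (u, w₀)
         rw [Set.Icc.coe_one, one_smul] }⟩
  obtain ⟨τ, hτ⟩ := (ContinuousMap.homotopic_iff_loopConj c cpush).1 hfree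
  have hpush : cpush.circleLoop = push := Path.ext (funext fun t => rfl)
  have hT : pathConj τ.symm (FundamentalGroup.fromPath (Path.Homotopic.Quotient.mk c.circleLoop)) = gp := by
    rw [pathConj_fromPath, Path.symm_symm]
    show _ = FundamentalGroup.fromPath (Path.Homotopic.Quotient.mk push)
    rw [← hpush, hτ]
  have hs : Function.Surjective ((pathConj τ.symm).symm.toMonoidHom : _ →* _) :=
    (pathConj τ.symm).symm.surjective
  have himg := congrArg (Subgroup.map (pathConj τ.symm).symm.toMonoidHom) hgen
  rw [Subgroup.map_normalClosure _ _ hs, Set.image_singleton, Subgroup.map_top_of_surjective _ hs,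
    MulEquiv.coe_toMonoidHom, ← hT, MulEquiv.symm_apply_apply] at himg
  exact himg

end Literature.Topology.FourManifolds

end
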